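import Mathlib
import HarnessLib
import Summits.NavierStokesRegularity.NavierStokesRegularity.Theses.RootDecompIntermittency
import Summits.NavierStokesRegularity.NavierStokesRegularity.Theorems.RootDecompIntermittencyNoThinFrontierBlowupStubCs14Criterion
import Summits.NavierStokesRegularity.NavierStokesRegularity.Theorems.RootDecompIntermittencyNoThinFrontierBlowupStubFrontierL2Apriori

/-!
# RootDecompIntermittency — item `NoActivelyThinBlowup` (S₁, stmt-NavierStokesRegularity-27235) PROVED

**No actively-filamentary blow-up.** If every SATURATED Littlewood–Paley shell of a classical
Navier–Stokes solution `u` on `ℝ³ × [0,T)` (Leray–Hopf from its rapidly decaying datum) is `1`-thin at all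
late times — `‖Δ̇_j u(t)‖_∞ ≤ C 2^j ‖Δ̇_j u(t)‖₂` whenever `‖Δ̇_j u(t)‖_∞ ≥ c₀ ν 2^j`, for every threshold
`c₀ ∈ (0,1]` — then `u` extends smoothly past `T`. The item's docstring records it as "provable now from
print, not in print" (print: Cheskidov–Shvydkoy 2014 Thm 5.1 is the time-averaged, frontier-only, `D > 3/2`
statement); it is the first rung inside the crux `NoThinFrontierBlowup` X₁ (27233) of this route.

Proof = the two LANDED registered stubs of X₁ plus one line of Bernstein bookkeeping:
* `Theorems.NoThinFrontierBlowup.stub_frontierL2Apriori` (p792929): a thin frontier makes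
  `t ↦ Λ_{c₀,ν}(u(t))²` integrable on the terminal window (energy inequality);
* pointwise, the critical functional `sup_{2^j ≤ Λ} 2^j ‖Δ̇_j u‖_∞` is at most `K Λ²` with
  `K = c₀ν + C⁺ C₂ (2E₀)^{1/2}`: an unsaturated shell gives `2^j‖Δ̇_j u‖_∞ < c₀ν 4^j ≤ c₀ν Λ²`, a thin
  saturated one `≤ C 4^j ‖Δ̇_j u‖₂ ≤ C C₂ ‖u(t)‖₂ 4^j ≤ C C₂ (2E₀)^{1/2} Λ²` (`LPBounds.two_le`, Leray's
  energy inequality `IsLerayHopfOn.lintegral_enorm_sq_le`);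
* hence the critical functional is integrable on the window, and
  `Theorems.NoThinFrontierBlowup.stub_cs14Criterion` (p796816; Cheskidov–Dai 2015 Thm 1.1 in the tree's
  house form) gives the smooth extension, at the threshold `c₀ := c_s` it provides.
Navier–Stokes regularity is NOT proved by anything here (S₁ is an aside of the route, outside the cone of
`closes`; rung 0). decomp-ns writer g13.
[cite: CheskidovShvydkoy2011, §3 (definition of Λ); CheskidovDai2015, §1 Thm. 1.1]
-/

-- the summit and its single sub-problem share the name (CONVENTIONS §1), as in every Theorems file
set_option linter.dupNamespace false

open MeasureTheory Set Filter Topology Function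
open scoped ENNReal NNReal

namespace Summit.NavierStokesRegularity.NavierStokesRegularity.Theorems.NoActivelyThinBlowup

open Literature.Analysis.FluidPDE Literature.Analysis.FunctionSpaces

/-- **Bernstein bookkeeping at thinness `D = 1`.** If every saturated shell of `v` is `1`-thin with
constant `C`, then `sup_{2^j ≤ Λ_{c₀,ν}(v)} 2^j ‖Δ̇_j v‖_∞ ≤ (c₀ν + C⁺ C₂ S₀) Λ_{c₀,ν}(v)²` for any bound
`S₀ ≥ ‖v‖₂`. [folklore] -/
theorem criticalSup_le_of_thinSaturated (K : LPBounds (Fin 3)) {c₀ ν C : ℝ}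
    {v : EuclideanSpace ℝ (Fin 3) → EuclideanSpace ℝ (Fin 3)} (hv : MemLp v 2 volume) {S₀ : ℝ≥0∞}
    (hS : eLpNorm v 2 volume ≤ S₀)
    (hthin : ∀ j : ℕ, IsSaturatedLevel c₀ ν v j →
      eLpNorm (blockFn (j : ℤ) v) ⊤ volume ≤
        ENNReal.ofReal (C * (2 : ℝ) ^ ((3 - (1 : ℝ)) / 2 * (j : ℝ))) * eLpNorm (blockFn (j : ℤ) v) 2 volume) :
    (⨆ (j : ℕ) (_ : (2 : ℝ≥0∞) ^ j ≤ dissipationWavenumber c₀ ν v),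
        (2 : ℝ≥0∞) ^ j * eLpNorm (blockFn (j : ℤ) v) ⊤ volume) ≤
      (ENNReal.ofReal (c₀ * ν) + ENNReal.ofReal (max C 0) * K.C₂ * S₀) *
        dissipationWavenumber c₀ ν v ^ 2 := by
  refine iSup₂_le fun j hj => ?_
  have hsq : ((2 : ℝ≥0∞) ^ j) ^ 2 ≤ dissipationWavenumber c₀ ν v ^ 2 := by gcongr
  by_cases hsat : IsSaturatedLevel c₀ ν v j
  · -- a thin saturated shell
    have h1 := hthin j hsat
    have hrpow : (2 : ℝ) ^ ((3 - (1 : ℝ)) / 2 * (j : ℝ)) = (2 : ℝ) ^ j := by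
      rw [show (3 - (1 : ℝ)) / 2 * (j : ℝ) = (j : ℝ) by ring, Real.rpow_natCast]
    have h2 : ENNReal.ofReal (C * (2 : ℝ) ^ ((3 - (1 : ℝ)) / 2 * (j : ℝ))) ≤
        ENNReal.ofReal (max C 0) * (2 : ℝ≥0∞) ^ j := by
      rw [hrpow]
      calc ENNReal.ofReal (C * (2 : ℝ) ^ j)
          ≤ ENNReal.ofReal (max C 0 * (2 : ℝ) ^ j) :=
            ENNReal.ofReal_le_ofReal (mul_le_mul_of_nonneg_right (le_max_left _ _) (by positivity))
        _ = ENNReal.ofReal (max C 0) * (2 : ℝ≥0∞) ^ j := by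
            rw [ENNReal.ofReal_mul (le_max_right _ _), ENNReal.ofReal_pow (by norm_num) j,
              ENNReal.ofReal_ofNat]
    have h3 : eLpNorm (blockFn (j : ℤ) v) 2 volume ≤ K.C₂ * S₀ :=
      (K.two_le j v hv).trans (by gcongr)
    calc (2 : ℝ≥0∞) ^ j * eLpNorm (blockFn (j : ℤ) v) ⊤ volume
        ≤ (2 : ℝ≥0∞) ^ j * (ENNReal.ofReal (max C 0) * (2 : ℝ≥0∞) ^ j * (K.C₂ * S₀)) := by
          gcongr
          exact h1.trans (mul_le_mul' h2 h3)
      _ = (ENNReal.ofReal (max C 0) * K.C₂ * S₀) * ((2 : ℝ≥0∞) ^ j) ^ 2 := by ring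
      _ ≤ (ENNReal.ofReal (c₀ * ν) + ENNReal.ofReal (max C 0) * K.C₂ * S₀) *
            dissipationWavenumber c₀ ν v ^ 2 := mul_le_mul' le_add_self hsq
  · -- an unsaturated shell
    have h1 : eLpNorm (blockFn (j : ℤ) v) ⊤ volume ≤ ENNReal.ofReal (c₀ * ν) * (2 : ℝ≥0∞) ^ j := by
      unfold IsSaturatedLevel at hsat
      exact (not_le.1 hsat).le
    calc (2 : ℝ≥0∞) ^ j * eLpNorm (blockFn (j : ℤ) v) ⊤ volume
        ≤ (2 : ℝ≥0∞) ^ j * (ENNReal.ofReal (c₀ * ν) * (2 : ℝ≥0∞) ^ j) := by gcongr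
      _ = ENNReal.ofReal (c₀ * ν) * ((2 : ℝ≥0∞) ^ j) ^ 2 := by ring
      _ ≤ (ENNReal.ofReal (c₀ * ν) + ENNReal.ofReal (max C 0) * K.C₂ * S₀) *
            dissipationWavenumber c₀ ν v ^ 2 := mul_le_mul' le_self_add hsq

/-- **Item `NoActivelyThinBlowup` (stmt-NavierStokesRegularity-27235) of route RootDecompIntermittency, by
name** — no actively-filamentary blow-up, from the two landed stubs of the crux `NoThinFrontierBlowup`.
[cite: CheskidovDai2015, §1 Thm. 1.1] -/
theorem noActivelyThinBlowup_proof : Theses.RootDecompIntermittency.NoActivelyThinBlowup := by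
  intro ν T hν hT u p hsol hLH h₀ hthin
  obtain ⟨cs, hcs, hcs1, hcrit⟩ := NoThinFrontierBlowup.stub_cs14Criterion
  obtain ⟨C, t₀, ht₀T, hC⟩ := hthin cs hcs hcs1
  -- the terminal window `(t₁, T)`, `t₁ = max t₀ 0`
  set t₁ : ℝ := max t₀ 0 with ht₁
  have ht₁0 : 0 ≤ t₁ := le_max_right _ _
  have ht₁T : t₁ < T := max_lt ht₀T hT
  have hsub : ∀ t ∈ Ioo t₁ T, t ∈ Ioo t₀ T := fun t ht => ⟨(le_max_left _ _).trans_lt ht.1, ht.2⟩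
  -- the thin frontier makes `Λ²` integrable on the window (landed stub, p792929)
  have hΛ : (∫⁻ t in Ioo t₁ T, dissipationWavenumber cs ν (u t) ^ 2) < ⊤ :=
    NoThinFrontierBlowup.stub_frontierL2Apriori cs hcs hcs1 ν T hν hT u p hsol hLH C t₁ ht₁0 ht₁T
      (fun t ht j hj => hC t (hsub t ht) j hj.1)
  -- Leray's energy inequality: a uniform `L²` bound of the slices
  set S₀ : ℝ≥0∞ := (ENNReal.ofReal (2 * VectorCalculus.kineticEnergy (u 0))) ^ (1 / 2 : ℝ) with hS₀
  have hS₀top : S₀ ≠ ⊤ := ENNReal.rpow_ne_top_of_nonneg (by norm_num) ENNReal.ofReal_ne_top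
  have hS : ∀ t ∈ Ioo t₁ T, eLpNorm (u t) 2 volume ≤ S₀ := fun t ht => by
    have hmem : t ∈ Icc 0 T := ⟨ht₁0.trans ht.1.le, ht.2.le⟩
    rw [Literature.Analysis.FunctionSpaces.eLpNorm_two_eq_pow_two_rpow_half,
      Literature.Analysis.FunctionSpaces.eLpNorm_two_pow_two_eq_lintegral, hS₀]
    exact ENNReal.rpow_le_rpow (hLH.lintegral_enorm_sq_le hν.le hmem) (by norm_num)
  -- the pointwise bound `critical functional ≤ K Λ²`
  set Kc : ℝ≥0∞ := ENNReal.ofReal (cs * ν) + ENNReal.ofReal (max C 0) * (lpBounds (Fin 3)).C₂ * S₀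
    with hKc
  have hKtop : Kc ≠ ⊤ :=
    ENNReal.add_ne_top.2 ⟨ENNReal.ofReal_ne_top, ENNReal.mul_ne_top
      (ENNReal.mul_ne_top ENNReal.ofReal_ne_top ENNReal.coe_ne_top) hS₀top⟩
  have hG : ∀ t ∈ Ioo t₁ T,
      (⨆ (j : ℕ) (_ : (2 : ℝ≥0∞) ^ j ≤ dissipationWavenumber cs ν (u t)),
        (2 : ℝ≥0∞) ^ j * eLpNorm (blockFn (j : ℤ) (u t)) ⊤ volume) ≤
        Kc * dissipationWavenumber cs ν (u t) ^ 2 := fun t ht =>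
    criticalSup_le_of_thinSaturated (lpBounds (Fin 3))
      (hLH.memLp t ⟨ht₁0.trans ht.1.le, ht.2.le⟩) (hS t ht) (fun j hj => hC t (hsub t ht) j hj)
  -- so the critical functional is integrable on the window
  have hint : (∫⁻ t in Ioo t₁ T, (⨆ (j : ℕ) (_ : (2 : ℝ≥0∞) ^ j ≤ dissipationWavenumber cs ν (u t)),
      (2 : ℝ≥0∞) ^ j * eLpNorm (blockFn (j : ℤ) (u t)) ⊤ volume)) < ⊤ :=
    calc ∫⁻ t in Ioo t₁ T, (⨆ (j : ℕ) (_ : (2 : ℝ≥0∞) ^ j ≤ dissipationWavenumber cs ν (u t)),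
          (2 : ℝ≥0∞) ^ j * eLpNorm (blockFn (j : ℤ) (u t)) ⊤ volume)
        ≤ ∫⁻ t in Ioo t₁ T, Kc * dissipationWavenumber cs ν (u t) ^ 2 :=
          lintegral_mono_ae ((ae_restrict_mem measurableSet_Ioo).mono fun t ht => hG t ht)
      _ = Kc * ∫⁻ t in Ioo t₁ T, dissipationWavenumber cs ν (u t) ^ 2 :=
          lintegral_const_mul' _ _ hKtop
      _ < ⊤ := ENNReal.mul_lt_top hKtop.lt_top hΛ
  -- the Cheskidov–Shvydkoy / Cheskidov–Dai criterion (landed stub, p796816) fires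
  exact hcrit cs hcs le_rfl ν T hν hT u p hsol hLH h₀ t₁ ht₁0 ht₁T hint

end Summit.NavierStokesRegularity.NavierStokesRegularity.Theorems.NoActivelyThinBlowup
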